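import Summits.CriticalPhenomena.SAWScalingLimit.Theses.SAWDefectDecoherence
import Summits.CriticalPhenomena.SAWScalingLimit.Theses.SAWPhaseRetrieval
import Summits.CriticalPhenomena.SAWScalingLimit.Theses.SAWWindingAlias
import Summits.CriticalPhenomena.SAWScalingLimit.Theses.SAWDevelopingMap
import Summits.CriticalPhenomena.SAWScalingLimit.Theses.SAWTrackTransport
import Summits.CriticalPhenomena.SAWScalingLimit.Theses.SAWCompassLattice
import Summits.CriticalPhenomena.SAWScalingLimit.Theorems.SAWDevelopingMapHexTransferCompassEndpoints
import Summits.CriticalPhenomena.SAWScalingLimit.Theorems.SAWDevelopingMapHexTransferSimilarityIdentification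
import Summits.CriticalPhenomena.SAWScalingLimit.Theorems.SAWDevelopingMapHexTransferPortTransferWeakLimit
import Summits.CriticalPhenomena.SAWScalingLimit.Theorems.SAWDevelopingMapHexTransferConjugateRotationCovariance
import Literature.Probability.RandomPlanarGeometry.SLEUniquenessInLaw
import Literature.Probability.RandomPlanarGeometry.WeaklySAW
import Summits.CriticalPhenomena.SAWScalingLimit.Theorems.SAWDevelopingMapHexTransferYbRelayDefs
import Summits.CriticalPhenomena.SAWScalingLimit.Theorems.SAWDevelopingMapHexTransferDictionaryGlue
import Summits.CriticalPhenomena.SAWScalingLimit.Theorems.SAWDevelopingMapHexTransferAngleTransportOfTrackTransport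
import Summits.CriticalPhenomena.SAWScalingLimit.Theorems.SAWDevelopingMapHexTransferThirdBdryEndpoints
import Summits.CriticalPhenomena.SAWScalingLimit.Theorems.SAWDevelopingMapHexTransferGMHexDictionary

/-!
# Line `yb-relay` for the crux `HexTransfer` (stmt-CriticalPhenomena-14221) — skeleton v6
(line lead prover-line-stmt-CriticalPhenomena-14221-c4-0, 2026-08-17; v1 by the crux-strategist
planner-cstrat-stmt-CriticalPhenomena-14221-p1-0, `Cruxes/HexTransfer/Lines/yb_relay.lean`, card
`Lines/yb-relay.md`, census `STRATEGY-CENSUS.md` §5 d3).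

v4 → v5/v6 (2026-08-17, cycle 2): stub 0 `stub_thirdBdryEndpoints` LANDED (p141015, imported); the
exact dictionary `stub_gmHexDictionary` LANDED as an 8-file chain (Walks p140329, Geometry p140358,
Inverse p140724, Mesh p140725, Decode p141164, Chart p141428, Curves p142484, Main p142516; imported); the RESEARCH stub is
RE-TYPED IN THE WEAKER `∃`-FORM `stub_hexFaceRobustExists : HexSAWScalingLimit → HexFaceSLEExists`
(for every `D` SOME boundary `π/3` approximation whose face-domain hexagonal laws converge) — the
composition only ever needed one approximation per domain (`ybSquareSLE_of_stubs` picks one), the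
weakening `(∀-form) → (∃-form)` is proved below from the landed stub 0
(`hexFaceSLEExists_of_forall`), and the pointwise glue `ybThirdSLE_of_faceSLE_at` (appended to the
landed glue file, p141775) replaces the bundled `stub_dictionaryGlue` in the composition.

Crux: `HexTransfer := HexSAWScalingLimit ("(A)") → SAWScalingLimit` (route `SAWDevelopingMap`; identical
bodies in `SAWDefectDecoherence`, `SAWPhaseRetrieval`, `SAWWindingAlias`).

THE LINE = decomposition of the crux ALONG THE YANG–BAXTER FAMILY (Glazman–Manolescu arXiv:1708.00395:
the critical Yang–Baxter walk on `H(π/3)` IS the hexagonal SAW; the column exchange transports `H(π/3)`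
to `H(Θ)`), `(A)` consumed only by the composition.

RESHAPE v1 → v2 (lead's judgment, `NOTES.md`/`PICKED.md`): v1's stub 1 `HexThirdConventions` (an
(A)-free asymptotic equality `hexSAWLaw ≈ ybLaw (π/3)`) bundled an EXACT dictionary with a research
statement, and typed (A)-free the research part is harder than it needs to be. Here it is cut into
* `stub_gmHexDictionary` (provable, finite-mesh, EXACT): at `Θ ≡ π/3` the Glazman–Manolescu law from a
  boundary mid-edge `a` to a boundary mid-edge `b` of `Ω_δ` IS the push-forward of DCS's `hexSAWLaw` of
  an explicit planar domain (`faceDomain`: the preimage under the similarity `S_δ z = i z − iδ/2` of the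
  interior of the union of the closed rhombi of the face component of `a`) between the two boundary
  triangles (`bdryVertex`), along a map of walks moving curves by `≤ 2δ`; the geometry (face `(k, j)`,
  triangle `W–N` ↔ `HexVertex (![j, -k-1], 1)`, triangle `S–E` ↔ `(![j, -k-1], 0)`, `S_δ`) is computed in
  the lead's NOTES.md;
* `stub_hexFaceRobust : HexSAWScalingLimit → HexFaceSLE` (research, HEXAGONAL-ONLY): DCS Conjecture 1
  transported from the canonical discretisation of a fixed domain to the face domains of `D` (half-period
  lattice offset, faces-vs-vertices boundary layer, boundary-triangle endpoints) — boundary-layer and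
  endpoint decoupling of the critical hexagonal SAW, the honest open content of the convention bridge;
* `stub_dictionaryGlue` (provable; the lead closes it this cycle): dictionary + robustness ⇒ DCS
  Conjecture 1 in Glazman–Manolescu's `π/3` encoding for boundary endpoint approximations
  (`YBThirdSLEBdry`), by similarity covariance of SLE and "converging together";
and stub 0 is sharpened to BOUNDARY mid-edge approximations (`ThirdBdryEndpoints`, the form the exact
dictionary needs). Stubs 2–3 unchanged: `stub_angleTransport` (open; ⇐ SAWTrackTransport's 16995 ∧
16963) and `stub_ybToUniform` (= SAWTrackTransport.YBtoUniform, item stmt-16966 verbatim).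

Composition `HexTransfer_of_stubs` PROVED below; `HexTransfer_of` concludes the crux BY NAME (four copies).
Disproof read (`Cruxes/HexTransfer/Disproof.lean`, cycle 1): no `_false_without_` exists (one
hypothesis); (A) is consumed (in `HexTransfer_of_stubs` through `stub_hexFaceRobust`); §5/§6 respected
(no weights identified across lattices; `stub_angleTransport` asymptotic).
-/

noncomputable section

namespace Summit.CriticalPhenomena.SAWScalingLimit.Cruxes.HexTransfer.YbRelay

open MeasureTheory Filter Topology Set
open scoped NNReal ENNReal BoundedContinuousFunction
open Complex (I I_ne_zero)
open Literature.Probability.RandomPlanarGeometry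
open Literature.Probability.RandomPlanarGeometry.SAW
open Literature.Probability.RandomPlanarGeometry.SAW.YangBaxter
open Literature.Probability.LatticeModels (Site HexVertex hexGraph hexCenter)
open Summit.CriticalPhenomena.SAWScalingLimit.Theses
open Literature.Probability (Process.preWienerMeasure)

/-! ### The `π/3` dictionary vocabulary

`third`, `IsBdryEdge`, `triWN`, `triSE`, `triAt`, `inclFace`, `bdryVertex`, `gmSimilarity`, `faceAdj`,
`faceComp`, `faceUnion`, `faceDomain` are the reviewed Defs file
`Theorems/SAWDevelopingMapHexTransferYbRelayDefs.lean` (p138220, ACCEPTED, commit 0397f45fccb2), imported. -/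

/-! ### The stub statements -/

/-- Statement of stub 0 (**boundary endpoint approximations at `π/3`**): every Dobrushin domain admits
mid-edge endpoint approximations on `H(π/3)` through BOUNDARY edges of `Ω_δ`. [folklore] -/
def ThirdBdryEndpoints : Prop :=
  ∀ D : DobrushinDomain, ∃ a b : ℝ → MidEdge, IsYBEndpointApprox third D a b ∧
    ∀ᶠ δ in 𝓝[>] (0 : ℝ), IsBdryEdge (meshFaces third D.carrier δ) (a δ) ∧
      IsBdryEdge (meshFaces third D.carrier δ) (b δ)

/-- Statement of stub 1a (**the exact `π/3` dictionary**, Glazman–Manolescu p. 3: "if `Θ` is the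
constant sequence equal to `π/3` … the model becomes that on the hexagonal lattice … with weight
`(1/√(2+√2))^{|γ|}`"), at the level of the finite-domain LAWS: for boundary edges `a ≠ b` of `Ω_δ`
joined by a walk, the critical Yang–Baxter law is the push-forward of the critical hexagonal SAW law of
the face domain between the boundary vertices along a map of walks whose drawn curves are `2δ`-close
(GM polyline through mid-edge points vs `S_δ` of the honeycomb polyline through triangle centres).
[cite: GlazmanManolescu2019, §1 p. 3 and Fig. 2] -/
def GMHexDictionary : Prop :=
  ∀ (Ω : Set ℂ) (δ : ℝ), 0 < δ → ∀ a b : MidEdge, a ≠ b →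
    IsBdryEdge (meshFaces third Ω δ) a → IsBdryEdge (meshFaces third Ω δ) b →
    Nonempty (YangBaxterSAW third Ω δ a b) →
    ∃ φ : HexDomainSAW (faceDomain Ω δ a) δ (bdryVertex (meshFaces third Ω δ) a)
        (bdryVertex (meshFaces third Ω δ) b) → YangBaxterSAW third Ω δ a b,
      ybLaw third Ω δ 1 a b =
        (hexSAWLaw (faceDomain Ω δ a) δ (bdryVertex (meshFaces third Ω δ) a)
          (bdryVertex (meshFaces third Ω δ) b)).map φ ∧
      ∀ γ, dist ((φ γ).curve third δ) (CurveClass.map (gmSimilarity δ : C(ℂ, ℂ)) γ.curve) ≤ 2 * δ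

/-- Statement of the research stub's conclusion (**DCS Conjecture 1 on the face domains**): for every
Dobrushin domain `D` and every `π/3` endpoint approximation through boundary edges, the critical
hexagonal SAW law of the face domain of `D` at mesh `δ`, between the boundary vertices, converges in
law to chordal SLE(8/3) in `S₀⁻¹ D` (`S₀ z = i z`; the face domains sit in `S₀⁻¹ D` shifted by `δ/2` and
trimmed by an `O(δ)` boundary layer). [folklore] -/
def HexFaceSLE : Prop :=
  ∀ (D : DobrushinDomain) (a b : ℝ → MidEdge), IsYBEndpointApprox third D a b →
    (∀ᶠ δ in 𝓝[>] (0 : ℝ), IsBdryEdge (meshFaces third D.carrier δ) (a δ) ∧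
      IsBdryEdge (meshFaces third D.carrier δ) (b δ)) →
    ConvergesInLawToSLE ((8 : ℝ≥0) / 3) (D.map (similarity I I_ne_zero 0).symm)
      (fun δ (γ : HexDomainSAW (faceDomain D.carrier δ (a δ)) δ
          (bdryVertex (meshFaces third D.carrier δ) (a δ))
          (bdryVertex (meshFaces third D.carrier δ) (b δ))) => γ.curve)
      (fun δ => hexSAWLaw (faceDomain D.carrier δ (a δ)) δ
          (bdryVertex (meshFaces third D.carrier δ) (a δ))
          (bdryVertex (meshFaces third D.carrier δ) (b δ)))

/-- The research stub's conclusion in `∃`-form (v5): for every Dobrushin domain `D` there is SOME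
`π/3` endpoint approximation through boundary edges along which the critical hexagonal SAW laws of the
face domains of `D` converge in law to chordal SLE(8/3) in `S₀⁻¹ D`. Weaker than `HexFaceSLE` given
stub 0 (`hexFaceSLEExists_of_forall`), and all the composition needs. [folklore] -/
def HexFaceSLEExists : Prop :=
  ∀ D : DobrushinDomain, ∃ a b : ℝ → MidEdge, IsYBEndpointApprox third D a b ∧
    (∀ᶠ δ in 𝓝[>] (0 : ℝ), IsBdryEdge (meshFaces third D.carrier δ) (a δ) ∧
      IsBdryEdge (meshFaces third D.carrier δ) (b δ)) ∧
    ConvergesInLawToSLE ((8 : ℝ≥0) / 3) (D.map (similarity I I_ne_zero 0).symm)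
      (fun δ (γ : HexDomainSAW (faceDomain D.carrier δ (a δ)) δ
          (bdryVertex (meshFaces third D.carrier δ) (a δ))
          (bdryVertex (meshFaces third D.carrier δ) (b δ))) => γ.curve)
      (fun δ => hexSAWLaw (faceDomain D.carrier δ (a δ)) δ
          (bdryVertex (meshFaces third D.carrier δ) (a δ))
          (bdryVertex (meshFaces third D.carrier δ) (b δ)))

/-- **DCS Conjecture 1 in Glazman–Manolescu's `π/3` encoding, `∃`-form**: every Dobrushin domain has
a `π/3` endpoint approximation along which the critical Yang–Baxter law of `H(π/3)` converges in law
to chordal SLE(8/3). [folklore] -/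
def YBThirdSLEExists : Prop :=
  ∀ D : DobrushinDomain, ∃ a b : ℝ → MidEdge, IsYBEndpointApprox third D a b ∧
    ConvergesInLawToSLE ((8 : ℝ≥0) / 3) D
      (fun δ (γ : YangBaxterSAW third D.carrier δ (a δ) (b δ)) => γ.curve third δ)
      (fun δ => ybLaw third D.carrier δ 1 (a δ) (b δ))

/-- **DCS Conjecture 1 in Glazman–Manolescu's `π/3` encoding** (boundary endpoint approximations): the
critical Yang–Baxter law of `H(π/3)` converges in law to chordal SLE(8/3). [folklore] -/
def YBThirdSLEBdry : Prop :=
  ∀ (D : DobrushinDomain) (a b : ℝ → MidEdge), IsYBEndpointApprox third D a b →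
    (∀ᶠ δ in 𝓝[>] (0 : ℝ), IsBdryEdge (meshFaces third D.carrier δ) (a δ) ∧
      IsBdryEdge (meshFaces third D.carrier δ) (b δ)) →
    ConvergesInLawToSLE ((8 : ℝ≥0) / 3) D
      (fun δ (γ : YangBaxterSAW third D.carrier δ (a δ) (b δ)) => γ.curve third δ)
      (fun δ => ybLaw third D.carrier δ 1 (a δ) (b δ))

/-- Statement of stub 2 (**law-level Yang–Baxter transport inside the family, `π/3 ↔ π/2`**), as in
v1: the critical Glazman–Manolescu laws at `Θ ≡ π/3` and `Θ ≡ π/2` are asymptotically equal on bounded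
continuous test functions; ⇐ SAWTrackTransport's `YBLimitExists` (16995) ∧ `AngleUniversality` (16963).
[cite: GlazmanManolescu2019, §4] [cite: DKKMO2020Rotational, Theorem 2.1 and Theorem 2.4] -/
def AngleTransport : Prop :=
  ∀ (D : DobrushinDomain) (a b a' b' : ℝ → MidEdge),
    IsYBEndpointApprox (fun (_ : ℤ) => Real.pi / 3) D a b →
    IsYBEndpointApprox (fun (_ : ℤ) => Real.pi / 2) D a' b' →
    ∀ f : BoundedContinuousFunction (CurveClass ℂ) ℝ,
      Tendsto (fun δ : ℝ =>
          (∫ γ, f (γ.curve (fun (_ : ℤ) => Real.pi / 3) δ)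
              ∂(ybLaw (fun (_ : ℤ) => Real.pi / 3) D.carrier δ 1 (a δ) (b δ))) -
            ∫ γ, f (γ.curve (fun (_ : ℤ) => Real.pi / 2) δ)
              ∂(ybLaw (fun (_ : ℤ) => Real.pi / 2) D.carrier δ 1 (a' δ) (b' δ)))
        (𝓝[>] (0 : ℝ)) (𝓝 0)

/-! ### Registered stubs

The stub theorems are stated UNFOLDED (no workfile-local `def … : Prop` in their headers), over the
vocabulary of the reviewed Defs file `Theorems/SAWDevelopingMapHexTransferYbRelayDefs.lean` (p138xxx;
identical copies above until it lands) and the Literature, so that a worker's landed theorem matches the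
registered header verbatim; each is definitionally the corresponding `def` above. -/

/- Stub 0 `stub_thirdBdryEndpoints : ThirdBdryEndpoints` (unfolded) is CLOSED: landed as
`Theorems/SAWDevelopingMapHexTransferThirdBdryEndpoints.lean` (p141015, ACCEPTED, commit 0318aa8792c0;
helpers p139448 `…FaceChains`, p139637 `…Geometry`), imported above and used below by name; it proves
the approximations at every constant angle `θ ∈ [π/3, 2π/3]` (`ybBdryEndpoints_of_mem_Icc`). -/

/-- The landed stub 0, folded. [folklore] -/
theorem thirdBdryEndpoints : ThirdBdryEndpoints := stub_thirdBdryEndpoints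

/- Stub 1a `stub_gmHexDictionary : GMHexDictionary` (unfolded; the exact `π/3` dictionary at law level) is
CLOSED: landed as `Theorems/SAWDevelopingMapHexTransferGMHexDictionary.lean` (p142516) over the seven helper
files `…GMHexDictionary{Walks,Geometry,Inverse,Mesh,Decode,Chart,Curves}.lean` (p140329, p140358, p140724,
p140725, p141164, p141428, p142484), imported above and used below by name. -/

/-- The landed stub 1a, folded. [cite: GlazmanManolescu2019, §1 p. 3 and Fig. 2] -/
theorem gmHexDictionary : GMHexDictionary := stub_gmHexDictionary

/-- Stub 1b (RESEARCH; held by the lead), v5 `∃`-FORM: robustness of DCS Conjecture 1 under the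
change of discretisation conventions for ONE boundary approximation per domain — unfolded
`HexSAWScalingLimit → HexFaceSLEExists`: for every Dobrushin domain `D`, SOME `π/3` endpoint
approximation through boundary edges of `Ω_δ` (the prover of this stub chooses it; stub 0 supplies
candidates at will) along which the critical hexagonal SAW laws of the face domains of `D` (offset
honeycomb `S_δ⁻¹`, one partial boundary layer of triangles trimmed, boundary-triangle endpoints)
converge to chordal SLE(8/3) in `S₀⁻¹ D`. No source proves it: it is the endpoint/boundary-layer
decoupling of the critical hexagonal SAW (census in the lead's NOTES.md / `Lines/yb-relay-hexFaceRobust-census.md`). -/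
theorem stub_hexFaceRobustExists : HexSAWScalingLimit → ∀ D : DobrushinDomain, ∃ a b : ℝ → MidEdge, IsYBEndpointApprox third D a b ∧ (∀ᶠ δ in 𝓝[>] (0 : ℝ), IsBdryEdge (meshFaces third D.carrier δ) (a δ) ∧ IsBdryEdge (meshFaces third D.carrier δ) (b δ)) ∧ ConvergesInLawToSLE ((8 : ℝ≥0) / 3) (D.map (similarity I I_ne_zero 0).symm) (fun δ (γ : HexDomainSAW (faceDomain D.carrier δ (a δ)) δ (bdryVertex (meshFaces third D.carrier δ) (a δ)) (bdryVertex (meshFaces third D.carrier δ) (b δ))) => γ.curve) (fun δ => hexSAWLaw (faceDomain D.carrier δ (a δ)) δ (bdryVertex (meshFaces third D.carrier δ) (a δ)) (bdryVertex (meshFaces third D.carrier δ) (b δ))) := by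
  sorry

/-- The v5 reshape is a WEAKENING: the v4 `∀`-form of the research stub (`HexSAWScalingLimit →
HexFaceSLE`) implies the `∃`-form, by the landed stub 0. [folklore] -/
theorem hexFaceSLEExists_of_forall (h : HexSAWScalingLimit → HexFaceSLE) :
    HexSAWScalingLimit → HexFaceSLEExists := by
  intro hA D
  obtain ⟨a, b, hab, hbd⟩ := thirdBdryEndpoints D
  exact ⟨a, b, hab, hbd, h hA D a b hab hbd⟩

/- Stub 1c `stub_dictionaryGlue : GMHexDictionary → HexFaceSLE → YBThirdSLEBdry` (unfolded) is CLOSED: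
landed as `Theorems/SAWDevelopingMapHexTransferDictionaryGlue.lean` (p138559, ACCEPTED, commit c344a6163ffa);
its pointwise form `ybThirdSLE_of_faceSLE_at` (same file, appended, p141775) is what the v5 composition uses. -/

/-- **Glue, `∃`-form**: the exact dictionary and face-domain convergence along one approximation per
domain give the `π/3` Yang–Baxter limit along that approximation. [folklore] -/
theorem ybThirdSLEExists_of (hD : GMHexDictionary) (hR : HexFaceSLEExists) : YBThirdSLEExists := by
  intro D
  obtain ⟨a, b, hab, hbd, hconv⟩ := hR D
  exact ⟨a, b, hab, ybThirdSLE_of_faceSLE_at hD D a b hab hbd hconv⟩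

/-- Stub 2 (open-problem; delegable only for its reduction to SAWTrackTransport's items 16995 ∧ 16963):
law-level Yang–Baxter transport `π/3 ↔ π/2` — unfolded `AngleTransport` (Literature vocabulary only). -/
theorem stub_angleTransport : ∀ (D : DobrushinDomain) (a b a' b' : ℝ → MidEdge), IsYBEndpointApprox (fun (_ : ℤ) => Real.pi / 3) D a b → IsYBEndpointApprox (fun (_ : ℤ) => Real.pi / 2) D a' b' → ∀ f : BoundedContinuousFunction (CurveClass ℂ) ℝ, Tendsto (fun δ : ℝ => (∫ γ, f (γ.curve (fun (_ : ℤ) => Real.pi / 3) δ) ∂(ybLaw (fun (_ : ℤ) => Real.pi / 3) D.carrier δ 1 (a δ) (b δ))) - ∫ γ, f (γ.curve (fun (_ : ℤ) => Real.pi / 2) δ) ∂(ybLaw (fun (_ : ℤ) => Real.pi / 2) D.carrier δ 1 (a' δ) (b' δ))) (𝓝[>] (0 : ℝ)) (𝓝 0) := by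
  sorry

/-- Where stub 2 sits (kernel-checked, LANDED p138469 by worker W2 as
`Theorems/SAWDevelopingMapHexTransferAngleTransportOfTrackTransport.lean`): `AngleTransport` follows from
route SAWTrackTransport's items `YBLimitExists` (stmt-16995) and `AngleUniversality` (stmt-16963).
[folklore] -/
theorem angleTransport_of_items (h₁ : SAWTrackTransport.YBLimitExists)
    (h₂ : SAWTrackTransport.AngleUniversality) : AngleTransport :=
  angleTransport_of_trackTransport h₁ h₂

/-- Stub 3 (= item stmt-CriticalPhenomena-16966 `SAWTrackTransport.YBtoUniform`, verbatim;
open-problem; never delegable from this line): the off-family toll. -/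
theorem stub_ybToUniform : SAWTrackTransport.YBtoUniform := by
  sorry

/-! ### The composition (sorry-free) -/

/-- The `π/3` Yang–Baxter limit along one approximation per domain and stub 2 give convergence of the
critical square-tiling Yang–Baxter law to chordal SLE(8/3) (`SAWCompassLattice.YBSquareSLE`, item
stmt-6967): take the `π/3` approximation and its SLE(8/3) limit, subtract stub 2. [folklore] -/
theorem ybSquareSLE_of_exists (h1 : YBThirdSLEExists) (h2 : AngleTransport) :
    SAWCompassLattice.YBSquareSLE := by
  intro D a' b' hab'
  obtain ⟨a₃, b₃, hab₃, Γ, hΓ, -, hT⟩ := h1 D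
  refine ⟨Γ, hΓ, Eventually.of_forall fun δ => YBWalk.aemeasurable_curve _ D.carrier δ 1 (a' δ) (b' δ),
    fun f => ?_⟩
  have h4 := (hT f).sub (h2 D a₃ b₃ a' b' hab₃ hab' f)
  rw [sub_zero] at h4
  exact h4.congr fun δ => sub_sub_cancel _ _

/-- v4's composition step, kept for the record: stubs 0, 1 (`∀`-form), 2 give `YBSquareSLE`. [folklore] -/
theorem ybSquareSLE_of_stubs (h0 : ThirdBdryEndpoints) (h1 : YBThirdSLEBdry) (h2 : AngleTransport) :
    SAWCompassLattice.YBSquareSLE :=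
  ybSquareSLE_of_exists (fun D => by
    obtain ⟨a₃, b₃, hab₃, hbd₃⟩ := h0 D
    exact ⟨a₃, b₃, hab₃, h1 D a₃ b₃ hab₃ hbd₃⟩) h2

/-- **`GMHexDictionary → (A → HexFaceSLEExists) → AngleTransport → YBtoUniform → HexTransfer`** (route
`SAWDefectDecoherence`'s copy; v5): (A) is consumed through the research stub; the exact dictionary and
the pointwise glue turn the face-domain limit into the `π/3` Yang–Baxter limit along one approximation
per domain; given a `δℤ²` endpoint approximation of `D`, pick a square-tiling one (landed
`Sketch.stub_compassEndpoints`), take the SLE(8/3) curve of `ybSquareSLE_of_exists` and add the toll.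
[folklore] -/
theorem HexTransfer_of_stubs (hD : GMHexDictionary) (hR : HexSAWScalingLimit → HexFaceSLEExists)
    (h2 : AngleTransport) (h3 : SAWTrackTransport.YBtoUniform) : SAWDefectDecoherence.HexTransfer := by
  intro hA D a b hab
  obtain ⟨a', b', hab'⟩ := Sketch.stub_compassEndpoints D
  obtain ⟨Γ, hΓ, -, hY⟩ := ybSquareSLE_of_exists (ybThirdSLEExists_of hD (hR hA)) h2 D a' b' hab'
  refine ⟨Γ, hΓ, Eventually.of_forall fun δ => aemeasurable_curve D.carrier δ (a δ) (b δ), fun f => ?_⟩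
  have h := (h3 D a b a' b' hab hab' f).add (hY f)
  rw [zero_add] at h
  exact h.congr fun δ => sub_add_cancel _ _

/-- **The crux from the line's registered stubs**, concluded BY NAME (route `SAWDefectDecoherence`). -/
theorem HexTransfer_of : SAWDefectDecoherence.HexTransfer :=
  HexTransfer_of_stubs stub_gmHexDictionary stub_hexFaceRobustExists stub_angleTransport stub_ybToUniform

/-- The same term closes route `SAWPhaseRetrieval`'s copy of the crux (identical body). -/
theorem HexTransfer_phaseRetrieval : SAWPhaseRetrieval.HexTransfer := HexTransfer_of

/-- The same term closes route `SAWWindingAlias`'s copy of the crux (identical body). -/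
theorem HexTransfer_windingAlias : SAWWindingAlias.HexTransfer := HexTransfer_of

/-- The same term closes route `SAWDevelopingMap`'s copy of the crux (identical body). -/
theorem HexTransfer_developingMap : SAWDevelopingMap.HexTransfer := HexTransfer_of

end Summit.CriticalPhenomena.SAWScalingLimit.Cruxes.HexTransfer.YbRelay

end
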